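import Literature.Analysis.Complex.LogNormLaplacianLineCount
import HarnessLib

/-!
# The Laplacian along a complex line is symmetric against compactly supported test functions

Layer `Literature/Analysis/Complex`; lane `lit-hodgefound`, prover seat `lit-hodgefound-p07`,
generation 19 — fourth rider towards FILE C (torus glue) of the programme «`[Θ_Ω] = -E_Ω` for
every `Ω ∈ 𝔥_g`». On a finite-dimensional complex inner product space `V` with a unit vector `v`,
write `Δ_v F (x) = D²F(x)[v, v] + D²F(x)[iv, iv]` for the Laplacian of `F` along the complex line
`x + ℂ v` (`LogNormLaplacianLineCount.laplacian_comp_add_smul`). Then for `F ∈ C²(V)` and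
`g ∈ C²_c(V)`,

  `∫_V F · Δ_v g = ∫_V (Δ_v F) · g`

(`integral_mul_lineLaplacian_eq_integral_lineLaplacian_mul`): slice `V = (ℂ v)^⊥ ⊕ ℂ v`
(`measurePreserving_add_smul`, Fubini), apply on each line the one-variable Green identity of
`LogNormLaplacianPairing.lean` (`integral_mul_laplacian_eq_integral_laplacian_mul`, Chirka's
"`∂∂̄`-integration by parts" in the proof of the Poincaré–Lelong formula, §16.3), and sum the
lines. In the torus glue this moves `Δ_v` from the weight `w` onto the explicit quadratic exponent
`q(z) = ᵗ(Im z)(Im Ω)⁻¹(Im z)` of the metric, whose line Laplacian is the constant `2 H_Ω(v, v)`.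

Theorems only; no definitions, no named facts.

## References

* [Chirka1989] E. M. Chirka, *Complex Analytic Sets*, Kluwer (1989), §16.3 Thm. 1 (proof,
  pp. 214–216: integration by parts of `∂∂̄` against test forms, fibrewise).
-/

noncomputable section

open MeasureTheory Set Filter Function Complex Metric Topology InnerProductSpace Module
open scoped Real Laplacian ENNReal

namespace Literature.Analysis.Complex

variable {V : Type*} [NormedAddCommGroup V] [InnerProductSpace ℂ V] [FiniteDimensional ℂ V]
  [MeasurableSpace V] [BorelSpace V]

omit [FiniteDimensional ℂ V] [MeasurableSpace V] [BorelSpace V] in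
/-- Continuity of the line Laplacian `x ↦ D²F(x)[v,v] + D²F(x)[iv,iv]` of a `C²` function.
[cite: Chirka1989, §16.3 (proof of Thm. 1)] -/
theorem continuous_lineLaplacian {F : V → ℝ} (hF : ContDiff ℝ 2 F) (v : V) :
    Continuous fun x => fderiv ℝ (fderiv ℝ F) x v v + fderiv ℝ (fderiv ℝ F) x (I • v) (I • v) := by
  have h2 : Continuous (fderiv ℝ (fderiv ℝ F)) :=
    (hF.fderiv_right (m := 1) le_rfl).continuous_fderiv one_ne_zero
  exact ((h2.clm_apply continuous_const).clm_apply continuous_const).add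
    ((h2.clm_apply continuous_const).clm_apply continuous_const)

omit [FiniteDimensional ℂ V] [MeasurableSpace V] [BorelSpace V] in
/-- The line Laplacian of a compactly supported function is compactly supported.
[cite: Chirka1989, §16.3 (proof of Thm. 1)] -/
theorem hasCompactSupport_lineLaplacian {g : V → ℝ} (hgc : HasCompactSupport g) (v : V) :
    HasCompactSupport fun x =>
      fderiv ℝ (fderiv ℝ g) x v v + fderiv ℝ (fderiv ℝ g) x (I • v) (I • v) := by
  have h : ∀ u : V, HasCompactSupport fun x => fderiv ℝ (fderiv ℝ g) x u u := fun u =>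
    (hgc.fderiv ℝ).fderiv ℝ |>.comp_left (g := fun L : V →L[ℝ] V →L[ℝ] ℝ => L u u) rfl
  exact (h v).add (h (I • v))

/-- **`∫ F · Δ_v g = ∫ (Δ_v F) · g`** for `F ∈ C²(V)`, `g ∈ C²_c(V)` and a unit vector `v` of the
finite-dimensional complex inner product space `V` (Lebesgue measure `𝓗^{dim_ℝ V}`), where
`Δ_v F = D²F[v,v] + D²F[iv,iv]` is the Laplacian along the complex line `ℂ v`: Fubini over
`V = (ℂ v)^⊥ ⊕ ℂ v` and the one-variable Green identity on each line.
[cite: Chirka1989, §16.3 Thm. 1 (proof, pp. 214–216)] -/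
theorem integral_mul_lineLaplacian_eq_integral_lineLaplacian_mul {F g : V → ℝ}
    (hF : ContDiff ℝ 2 F) (hg : ContDiff ℝ 2 g) (hgc : HasCompactSupport g) {v : V}
    (hv : ‖v‖ = 1) :
    ∫ x, F x * (fderiv ℝ (fderiv ℝ g) x v v + fderiv ℝ (fderiv ℝ g) x (I • v) (I • v))
        ∂(μHE[finrank ℝ V] : Measure V) =
      ∫ x, (fderiv ℝ (fderiv ℝ F) x v v + fderiv ℝ (fderiv ℝ F) x (I • v) (I • v)) * g x
        ∂(μHE[finrank ℝ V] : Measure V) := by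
  letI iV : InnerProductSpace ℝ V := InnerProductSpace.complexToReal
  letI iW : InnerProductSpace ℝ (ℂ ∙ v)ᗮ := InnerProductSpace.complexToReal
  rw [InnerProductSpace.euclideanHausdorffMeasure_eq_volume]
  have hσ := measurePreserving_add_smul hv
  set Lg : V → ℝ := fun x =>
    fderiv ℝ (fderiv ℝ g) x v v + fderiv ℝ (fderiv ℝ g) x (I • v) (I • v) with hLg
  set LF : V → ℝ := fun x =>
    fderiv ℝ (fderiv ℝ F) x v v + fderiv ℝ (fderiv ℝ F) x (I • v) (I • v) with hLF
  -- both integrands are continuous with compact support, hence integrable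
  have h1i : Integrable (fun x => F x * Lg x) volume := by
    refine Continuous.integrable_of_hasCompactSupport (hF.continuous.mul (continuous_lineLaplacian hg v)) ?_
    exact (hasCompactSupport_lineLaplacian hgc v).mul_left
  have h2i : Integrable (fun x => LF x * g x) volume := by
    refine Continuous.integrable_of_hasCompactSupport ((continuous_lineLaplacian hF v).mul hg.continuous) ?_
    exact hgc.mul_left
  -- transport to `W × ℂ` and slice
  have hT : ∀ {h : V → ℝ}, Integrable h volume →
      ∫ x, h x ∂volume = ∫ k : (ℂ ∙ v)ᗮ, ∫ t : ℂ, h ((k : V) + t • v) ∂volume ∂volume := by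
    intro h hh
    have hh' : Integrable (fun q : (ℂ ∙ v)ᗮ × ℂ => h ((q.1 : V) + q.2 • v)) (volume.prod volume) :=
      (hσ.integrable_comp hh.aestronglyMeasurable).2 hh
    rw [← hσ.map_eq, integral_map hσ.measurable.aemeasurable (hσ.map_eq.symm ▸ hh.aestronglyMeasurable)]
    exact integral_prod _ hh'
  rw [hT h1i, hT h2i]
  refine integral_congr_ae (ae_of_all _ fun k => ?_)
  -- the one-variable Green identity on the line `k + ℂ v`
  have hFl : ContDiffOn ℝ 2 (fun t : ℂ => F ((k : V) + t • v)) univ :=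
    (contDiff_comp_add_smul hF (k : V) v).contDiffOn
  have hgl := contDiff_comp_add_smul hg (k : V) v
  have hglc := hasCompactSupport_comp_add_smul hgc hv (k : V)
  have h := integral_mul_laplacian_eq_integral_laplacian_mul isOpen_univ hFl hgl hglc (subset_univ _)
  simp only [laplacian_comp_add_smul hg, laplacian_comp_add_smul hF] at h
  simpa only [hLg, hLF] using h

end Literature.Analysis.Complex
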